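/- Copyright: ym3-torus cell, WIDTH-5 ATTACH seat `ym-ust-19936-w4` (prover, g10), for crux `HistoryTailL` (stmt-QuantumFields-19936),
level-0 prefactor-free infrastructure (assembly skeleton) of LINE `local_insertion` (#13) ∕ K1.  Released under the licence of the surrounding project. -/
import Summits.QuantumFields.YangMills.Theorems.LocalInsertionTriangularPlaquetteBound
import Summits.QuantumFields.YangMills.Theorems.LocalInsertionOneLinkGaussianBoundSU2
import HarnessLib

/-!
# The single-plaquette exponential moment of `SU(2)` on the three-torus, modulo the partition-function LOWER bound

Support file (`--supports stmt-QuantumFields-19936 --as helper`): the ASSEMBLY SKELETON of the cell's level-0 PREFACTOR-FREE plan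
(memo `PREFACTOR-FREE-LEVEL0-w7g9.md`; LEAD ★w1-19936 g7 00:09:18Z ∕ 00:19:25Z).  The door
✓`PlaquetteExpMoment.integral_exp_mul_plaquette_le_of_sandwich` (★w7-19936 g9) bounds `⟨exp(λβ(N − Re tr U_p))⟩_{Λ,β}` by
`(zup∕zlow)^{1∕L^d}` given `zlow ≤ Z_π(β)` and `Z_π((1−λ)β) ≤ zup`.  Here, for `SU(2)` on `(ℤ∕nℤ)³` (`ρ := fundamentalRep (Fin 2)`, the
letters of the bridge ✓`T3FinestHeightTail.gibbsMeasure_real_eq_wilsonMeasure_real`), the UPPER half is DISCHARGED by the triangular bound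
✓`TriangularPlaquette.lintegral_exp_neg_mul_wilsonAction_le` (`Z_π(β′) ≤ z(β′)^{2n³−n²−n}`) and the one-link Gaussian bound
✓`OneLinkGaussianSU2.integral_exp_neg_mul_actionTerm_fundamentalRep_le` (`z(β′) ≤ 8∕(β′√β′)`, `β′ ≥ 1`):

* **`lintegral_exp_neg_mul_wilsonAction_su2_le`** — `Z_π(β′) ≤ ofReal ((8∕(β′√β′))^{2n³−n²−n})` for `β′ ≥ 1`;
* **`integral_exp_mul_plaquette_su2_le_of_lowerBound`** — for `n` even, `1 < n`, `0 ≤ λ`, `(1−λ)β ≥ 1` and ANY `zlow > 0` with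
  `ofReal zlow ≤ Z_π(β)` (DISPLAYED — the lower half (T1′), ★w7-19936 g9's pen):
  `∫ exp(λβ(2 − Re tr U_{(c₀;0,a)})) dμ_{Λ,β} ≤ ((8∕(((1−λ)β)√((1−λ)β)))^{2n³−n²−n} ∕ zlow)^{1∕n³}`;
* **`measureReal_largePlaquette_su2_le_of_lowerBound`** — the tail form `μ_{Λ,β}{θ ≤ ‖U_p − 1‖} ≤ (same)·e^{−λβθ²∕2}`.

With (T1′)'s `zlow = e^{−C·3n³}·(c·β^{−3∕2})^{2n³+1}` the right-hand side is `C₀·(1−λ)^{−3(2n³−n²−n)∕(2n³)}·β^{3(n²+n+1)∕(2n³)}` — the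
prefactor-free exponential moment (EM) with residual `β^{c∕n}`.

HONEST SCOPE.  A composition of tree theorems with one displayed hypothesis (`hZ`, the lower bound); nothing of (T1′), of (EM) as an
unconditional statement, of LINE #13's stubs, of `HistoryTailL` or of any crux is proved.  CAVEAT (LEAD g7): the residual `β^{c∕n}` is
NOT γ-uniform at fixed small `K` (`log β_K ∕ n_K ∋ log γ⁻¹∕(2L^{m+K})`); (EM) must be stated with `n, β` displayed and is never to be
worded as `stub_insertionHeightOne`.  YM₃ on T³ is rung R3 — not d = 4, not infinite volume, not a mass gap, not Clay.
-/

namespace Summit.QuantumFields.YangMills.Theorems.LocalInsertion.ExpMomentSU2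

open MeasureTheory
open scoped Matrix.Norms.L2Operator ENNReal
open Literature.MathematicalPhysics.QuantumFieldTheory
open Literature.MathematicalPhysics.QuantumLattice (fundamentalRep fundamentalRep_apply continuous_fundamentalRep
  fundamentalRep_mem_unitaryGroup)
open Summit.QuantumFields.YangMills.Theorems.LocalInsertion.TriangularPlaquette
open Summit.QuantumFields.YangMills.Theorems.LocalInsertion.OneLinkGaussianSU2

noncomputable section

/-- **THE UPPER BOUND ON THE `SU(2)` WILSON PARTITION FUNCTION OF THE THREE-TORUS, numerical form**: for `1 < n` and `β′ ≥ 1`,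
`Z_π(β′) = ∫⁻ exp(−β′·S_W) dπ ≤ ofReal ((8∕(β′√β′))^{2n³ − n² − n})` (`ρ := fundamentalRep (Fin 2)`; ✓`lintegral_exp_neg_mul_wilsonAction_le`
∘ ✓`integral_exp_neg_mul_actionTerm_fundamentalRep_le`). [folklore] -/
theorem lintegral_exp_neg_mul_wilsonAction_su2_le {n : ℕ} [NeZero n] (hn : 1 < n) {β' : ℝ} (hβ' : 1 ≤ β') :
    ∫⁻ U, ENNReal.ofReal (Real.exp (-β' * wilsonAction (fundamentalRep (Fin 2)) U))
        ∂(Measure.pi fun _ : Edge 3 n => haarProbability (Matrix.specialUnitaryGroup (Fin 2) ℂ)) ≤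
      ENNReal.ofReal ((8 / (β' * Real.sqrt β')) ^ (2 * n ^ 3 - n ^ 2 - n)) := by
  have hβ'0 : 0 ≤ β' := zero_le_one.trans hβ'
  refine (lintegral_exp_neg_mul_wilsonAction_le hn (fundamentalRep (Fin 2)) fundamentalRep_mem_unitaryGroup
    (continuous_fundamentalRep (Fin 2)) hβ'0).trans ?_
  refine ENNReal.ofReal_le_ofReal (pow_le_pow_left₀ (integral_nonneg fun g => (Real.exp_pos _).le) ?_ _)
  exact integral_exp_neg_mul_actionTerm_fundamentalRep_le hβ'

/-- **THE SINGLE-PLAQUETTE EXPONENTIAL MOMENT OF `SU(2)` ON `(ℤ∕nℤ)³`, MODULO THE LOWER BOUND.**  For `n` even, `1 < n`, `0 ≤ λ`,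
`(1 − λ)β ≥ 1`, a direction `0 < a`, a site `c₀`, and ANY `zlow > 0` with `ofReal zlow ≤ Z_π(β)` (the tree-gauge lower bound (T1′),
displayed):
`∫ exp(λβ(2 − Re tr U_{(c₀;0,a)})) dμ_{Λ,β} ≤ ((8∕(((1−λ)β)·√((1−λ)β)))^{2n³−n²−n} ∕ zlow)^{1∕n³}`
(door ✓`integral_exp_mul_plaquette_le_of_sandwich` with `hZup` := `lintegral_exp_neg_mul_wilsonAction_su2_le`). [folklore] -/
theorem integral_exp_mul_plaquette_su2_le_of_lowerBound {n : ℕ} [NeZero n] (hn : 1 < n) (hne : Even n)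
    {β lam : ℝ} (hβ : 0 ≤ β) (hlam : 0 ≤ lam) (h1 : 1 ≤ (1 - lam) * β) {zlow : ℝ} (hzlow : 0 < zlow)
    (hZ : ENNReal.ofReal zlow ≤
      ∫⁻ U, ENNReal.ofReal (Real.exp (-β * wilsonAction (fundamentalRep (Fin 2)) U))
        ∂(Measure.pi fun _ : Edge 3 n => haarProbability (Matrix.specialUnitaryGroup (Fin 2) ℂ)))
    {a : Fin 3} (ha : (0 : Fin 3) < a) (c₀ : Site 3 n) :
    ∫ U, Real.exp (lam * β * (((2 : ℕ) : ℝ) - ((fundamentalRep (Fin 2)) (plaquetteHolonomy U c₀ 0 a)).trace.re))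
        ∂(wilsonMeasure (fundamentalRep (Fin 2)) β) ≤
      ((8 / (((1 - lam) * β) * Real.sqrt ((1 - lam) * β))) ^ (2 * n ^ 3 - n ^ 2 - n) / zlow) ^
        ((1 : ℝ) / (n : ℝ) ^ 3) := by
  have hzup : 0 ≤ (8 / (((1 - lam) * β) * Real.sqrt ((1 - lam) * β))) ^ (2 * n ^ 3 - n ^ 2 - n) := by positivity
  exact PlaquetteExpMoment.integral_exp_mul_plaquette_le_of_sandwich (d := 3) (L := n) (fundamentalRep (Fin 2))
    fundamentalRep_mem_unitaryGroup hne (continuous_fundamentalRep (Fin 2)) hβ ha hlam hzlow hzup hZ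
    (lintegral_exp_neg_mul_wilsonAction_su2_le hn h1) c₀

/-- **THE PREFACTOR-FREE SINGLE-PLAQUETTE TAIL OF `SU(2)` ON `(ℤ∕nℤ)³`, MODULO THE LOWER BOUND**: under the hypotheses of
`integral_exp_mul_plaquette_su2_le_of_lowerBound`, for every `θ ≥ 0`,
`μ_{Λ,β}{θ ≤ ‖U_{(c₀;0,a)} − 1‖} ≤ ((8∕(((1−λ)β)√((1−λ)β)))^{2n³−n²−n} ∕ zlow)^{1∕n³} · e^{−λβθ²∕2}`
(door ✓`measureReal_largePlaquette_le_of_sandwich`). [folklore] -/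
theorem measureReal_largePlaquette_su2_le_of_lowerBound {n : ℕ} [NeZero n] (hn : 1 < n) (hne : Even n)
    {β lam : ℝ} (hβ : 0 ≤ β) (hlam : 0 ≤ lam) (h1 : 1 ≤ (1 - lam) * β) {zlow : ℝ} (hzlow : 0 < zlow)
    (hZ : ENNReal.ofReal zlow ≤
      ∫⁻ U, ENNReal.ofReal (Real.exp (-β * wilsonAction (fundamentalRep (Fin 2)) U))
        ∂(Measure.pi fun _ : Edge 3 n => haarProbability (Matrix.specialUnitaryGroup (Fin 2) ℂ)))
    {a : Fin 3} (ha : (0 : Fin 3) < a) (c₀ : Site 3 n) {θ : ℝ} (hθ : 0 ≤ θ) :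
    (wilsonMeasure (fundamentalRep (Fin 2)) β).real
        {U : GaugeConfig 3 n (Matrix.specialUnitaryGroup (Fin 2) ℂ) |
          θ ≤ ‖(fundamentalRep (Fin 2)) (plaquetteHolonomy U c₀ 0 a) - 1‖} ≤
      ((8 / (((1 - lam) * β) * Real.sqrt ((1 - lam) * β))) ^ (2 * n ^ 3 - n ^ 2 - n) / zlow) ^
          ((1 : ℝ) / (n : ℝ) ^ 3) * Real.exp (-(lam * β * θ ^ 2 / 2)) := by
  have hzup : 0 ≤ (8 / (((1 - lam) * β) * Real.sqrt ((1 - lam) * β))) ^ (2 * n ^ 3 - n ^ 2 - n) := by positivity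
  exact PlaquetteExpMoment.measureReal_largePlaquette_le_of_sandwich (d := 3) (L := n) (fundamentalRep (Fin 2))
    fundamentalRep_mem_unitaryGroup hne (continuous_fundamentalRep (Fin 2)) hβ ha hlam hzlow hzup hZ
    (lintegral_exp_neg_mul_wilsonAction_su2_le hn h1) c₀ hθ

end

end Summit.QuantumFields.YangMills.Theorems.LocalInsertion.ExpMomentSU2
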